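import Summits.AtomisticToContinuum.HydrodynamicLimit.Theorems.CollisionIsometryCLTCollisionalTransferLocalityFluxForm
import Literature.Analysis.FunctionSpaces.TorusCalculusProofs
import HarnessLib

/-!
# The trace of the test gradient integrates to zero over the torus
(stub `integral_sum_gradPsi_diag_eq_zero`, line `hemisphere-affine-slaving`, crux
`CollisionalTransferLocality`, stmt-AtomisticToContinuum-9518)

Helper file (`--supports stmt-AtomisticToContinuum-9518`; registered stub
`integral_sum_gradPsi_diag_eq_zero`) of the line lead, equilibrium-rung infrastructure. In the
equilibrium rung the free-streaming term of the crux's residual has the one-time limit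
`θ ∫ Σ_a gradPsi ψ s x a a` (`stream_lln_const`), which must vanish: for the smooth slice `ψ s`
the trace of the Fréchet-based test gradient is the divergence,
`Σ_a gradPsi ψ s x a a = Σ_a ∂_a ψ_a (s, x) = div (ψ s) x` (`gradient_apply_eq_partialDeriv`,
components of smooth fields are smooth), and the divergence of a smooth field integrates to zero
over the flat torus (`Torus.integral_divergence_eq_zero_holds`; Evans, *PDE* (2010), App. C.2
Thm. 1 with empty boundary).

* `sum_gradPsi_diag_eq_divergence` — the pointwise identity `Σ_a gradPsi ψ s x a a = div (ψ s) x`;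
* `integral_sum_gradPsi_diag_eq_zero` — the registered stub `∫ Σ_a gradPsi ψ s x a a = 0`.
-/

namespace Summit.AtomisticToContinuum.HydrodynamicLimit.Theorems.HemisphereAffineSlaving

open scoped BigOperators Topology Classical ENNReal InnerProductSpace
open Filter Set Function MeasureTheory
open Literature.Analysis.FunctionSpaces

noncomputable section

open Literature.MathematicalPhysics.KineticTheory (T3 V3)

/-- For a smooth slice `ψ s`, the trace of the test gradient is the torus divergence:
`Σ_a gradPsi ψ s x a a = Σ_a ∂_a ψ_a (s, x) = div (ψ s) x` (the components of the Fréchet-based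
`Torus.gradient` of the `C¹` scalars `y ↦ ψ s y a` are their partial derivatives). -/
theorem sum_gradPsi_diag_eq_divergence {ψ : ℝ → T3 → V3} {s : ℝ} (hψ : Torus.IsSmooth (ψ s))
    (x : T3) : ∑ a, gradPsi ψ s x a a = Torus.divergence (ψ s) x := by
  simp only [gradPsi, Torus.divergence]
  exact Finset.sum_congr rfl fun a _ =>
    gradient_apply_eq_partialDeriv ((hψ.apply a).isContDiff (by simp)) x a

/-- **Registered stub `integral_sum_gradPsi_diag_eq_zero`** of crux stmt-AtomisticToContinuum-9518
(line hemisphere-affine-slaving, equilibrium rung): for a smooth slice `ψ s` the trace of the test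
gradient integrates to zero over the torus, `∫ Σ_a gradPsi ψ s x a a = ∫ div (ψ s) = 0`
(divergence theorem on the flat torus, no boundary; Evans, App. C.2 Thm. 1). -/
theorem integral_sum_gradPsi_diag_eq_zero : ∀ {ψ : ℝ → T3 → V3} {s : ℝ}, Literature.Analysis.FunctionSpaces.Torus.IsSmooth (ψ s) → ∫ x, (∑ a, gradPsi ψ s x a a) = 0 := by
  intro ψ s hψ
  simp_rw [sum_gradPsi_diag_eq_divergence hψ]
  exact Torus.integral_divergence_eq_zero_holds hψ

end

end Summit.AtomisticToContinuum.HydrodynamicLimit.Theorems.HemisphereAffineSlaving
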